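import Summits.ValiantsHypothesis.ValiantsHypothesis.Theorems.NcSemantics
import Summits.ValiantsHypothesis.ValiantsHypothesis.Theorems.NcOrderedTransfer
import Summits.ValiantsHypothesis.ValiantsHypothesis.Theorems.CommutativityDialSplit
import Summits.ValiantsHypothesis.ValiantsHypothesis.Theorems.NcPerTensorWidth
import HarnessLib

/-!
# NcSemanticsBridge — the route-free copy `NcSemantics` agrees with `CommutativityDial`
(decomposition workshop `decomp-valiant`, lens 6 «restricted-models lifting axis», gen 5; supports
`DecompCycle1.PerNotSmVP`, stmt-ValiantsHypothesis-23661)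

`Theorems/NcSemantics.lean` re-homes the noncommutative semantics `ncEval`, the ordered permanent
`ncPerPoly` and the pieces `PerNotNcVP` (`A_nc`), `NcLift` (`B_nc`) of `Theorems/CommutativityDial.lean`
in a module the route file can import (cone hygiene for the asides stmt-ValiantsHypothesis-23446–23448).
This file proves the two copies are THE SAME FUNCTIONS (`ncOperandEval_eq`, `ncGateEval_eq`,
`ncGateValues_eq`, `ncEval_eq`, `comm_eq`, `ncPerPoly_eq`), hence the pieces are equivalent
(`perNotNcVP_iff`, `ncLift_iff`), and TRANSPORTS every gen-4 edge that mentions a route item to the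
route-free names:

* `perNotNcVP_of_perNotSmVP : PerNotSmVP → NcSemantics.PerNotNcVP` (UNCONDITIONAL, via the kernel
  HWY10 Thm F.1 transfer `NcOrderedTransfer.ncToSmTransfer`);
* `tameOrSmLift_of_ncLift : NcSemantics.NcLift → TameOrSmLift` and `smLiftPer_of_ncLift`;
* `smToNcPer_iff : SmToNcPer ↔ (NcSemantics.PerNotNcVP → PerNotSmVP)` — the intended signature of the
  aside stmt-ValiantsHypothesis-23448 is the right-hand side;
* `perNotSmVP_iff_ncSplit : PerNotSmVP ↔ NcSemantics.PerNotNcVP ∧ (NcSemantics.PerNotNcVP → PerNotSmVP)`;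
* the Nisan rung read on the route-free ordered permanent (`ncAbpWidth_ncPerTensor`, by name — its
  statement does not mention `ncPerPoly`, so it needs no transport; recorded here for the dossier).

HONEST FRAMING: bookkeeping only; no new mathematics, nothing here bears on the truth of `VP ≠ VNP`.

## References

* [HrubesWigdersonYehudayoff2011] P. Hrubeš, A. Wigderson, A. Yehudayoff, *Non-commutative circuits
  and the sum-of-squares problem*, STOC 2010 / J. AMS 24 (2011), Thm 1.11, Thm F.1.
* [Nisan1991Noncommutative] N. Nisan, *Lower bounds for non-commutative computation*, STOC 1991, Thm 1.
-/

noncomputable section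

namespace Summit.ValiantsHypothesis.ValiantsHypothesis.Theorems.NcSemanticsBridge

open Literature.Computability.AlgebraicComplexity
open Summit.ValiantsHypothesis.ValiantsHypothesis.Theses.DecompCycle1 (PerNotSmVP TameOrSmLift)
open Summit.ValiantsHypothesis.ValiantsHypothesis.Theorems

universe u v

variable {k : Type u} {σ : Type v} [CommSemiring k]

/-! ## §1 The two copies are the same functions -/

/-- `CommutativityDial.ncOperandEval = NcSemantics.ncOperandEval` (same defining clauses). [folklore] -/
theorem ncOperandEval_eq (vals : List (FreeAlgebra k σ)) (u : ArithCircuit.Operand k σ) :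
    CommutativityDial.ncOperandEval vals u = NcSemantics.ncOperandEval vals u := by
  cases u <;> rfl

/-- `CommutativityDial.ncGateEval = NcSemantics.ncGateEval`. [folklore] -/
theorem ncGateEval_eq (vals : List (FreeAlgebra k σ)) (g : ArithCircuit.Gate k σ) :
    CommutativityDial.ncGateEval vals g = NcSemantics.ncGateEval vals g := by
  cases g <;> simp only [CommutativityDial.ncGateEval, NcSemantics.ncGateEval, ncOperandEval_eq]

/-- `CommutativityDial.ncGateValues = NcSemantics.ncGateValues`. [folklore] -/
theorem ncGateValues_eq (gs : List (ArithCircuit.Gate k σ)) :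
    CommutativityDial.ncGateValues gs = NcSemantics.ncGateValues gs := by
  induction gs using List.reverseRecOn with
  | nil => rfl
  | append_singleton gs g ih =>
    rw [CommutativityDial.ncGateValues_append_singleton, NcSemantics.ncGateValues_append_singleton, ih,
      ncGateEval_eq]

/-- **`CommutativityDial.ncEval = NcSemantics.ncEval`**: the gen-4 and the route-free noncommutative
semantics coincide on every circuit. [folklore] -/
theorem ncEval_eq (P : ArithCircuit k σ) : CommutativityDial.ncEval P = NcSemantics.ncEval P := by
  rw [CommutativityDial.ncEval, NcSemantics.ncEval, ncGateValues_eq, ncOperandEval_eq]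

/-- The two commutative-image maps coincide. [folklore] -/
theorem comm_eq : (CommutativityDial.comm : FreeAlgebra k σ →ₐ[k] MvPolynomial σ k) = NcSemantics.comm :=
  rfl

/-- The two ordered permanents coincide. [folklore] -/
theorem ncPerPoly_eq (n : ℕ) : CommutativityDial.ncPerPoly (k := k) n = NcSemantics.ncPerPoly n := rfl

/-! ## §2 The pieces are equivalent -/

/-- `A_nc` (gen 4) `⟺ A_nc` (route-free). [folklore] -/
theorem perNotNcVP_iff : CommutativityDial.PerNotNcVP ↔ NcSemantics.PerNotNcVP := by
  simp only [CommutativityDial.PerNotNcVP, NcSemantics.PerNotNcVP, ncEval_eq, ncPerPoly_eq]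

/-- `B_nc` (gen 4) `⟺ B_nc` (route-free). [folklore] -/
theorem ncLift_iff : CommutativityDial.NcLift ↔ NcSemantics.NcLift := by
  simp only [CommutativityDial.NcLift, NcSemantics.NcLift, ncEval_eq, ncPerPoly_eq]

/-! ## §3 Transported edges to the route items of `DecompCycle1` -/

/-- **`A ⟹ A_nc` unconditionally** (route-free name): syntactically-multilinear hardness of `per`
(stmt-ValiantsHypothesis-23661) implies noncommutative hardness of the ordered permanent, through the
kernel HWY10 Thm F.1 transfer `ncToSmTransfer`. [cite: HrubesWigdersonYehudayoff2011, Thm 1.11] -/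
theorem perNotNcVP_of_perNotSmVP (hA : PerNotSmVP) : NcSemantics.PerNotNcVP :=
  perNotNcVP_iff.mp (NcOrderedTransfer.perNotNcVP_of_perNotSmVP hA)

/-- The HWY10 Thm F.1 transfer, read on the route-free semantics: an nc circuit for the ordered
permanent yields a syntactically multilinear circuit for `per` of size `≤ 64(n+1)^4(s+1)`.
[cite: HrubesWigdersonYehudayoff2011, Thm F.1] -/
theorem ncToSmTransfer (n : ℕ) (P : ArithCircuit ℂ (Fin n × Fin n)) (hP : P.IsFanInTwo)
    (hnc : NcSemantics.ncEval P = NcSemantics.ncPerPoly n) :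
    ∃ Q : ArithCircuit ℂ (Fin n × Fin n), Q.IsFanInTwo ∧ IsSyntacticallyMultilinear Q ∧
      Q.Computes (perPoly (Fin n) ℂ) ∧ Q.size ≤ 64 * (n + 1) ^ 4 * (P.size + 1) :=
  NcOrderedTransfer.ncToSmTransfer n P hP (by rw [ncEval_eq, ncPerPoly_eq]; exact hnc)

/-- **`B_nc ⟹` the sm-lift of `per`** (route-free name). [cite: HrubesWigdersonYehudayoff2011, Thm F.1] -/
theorem smLiftPer_of_ncLift (hB : NcSemantics.NcLift) (heq : VP ℂ = VNP ℂ) :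
    ∃ c : ℕ, ∀ n : ℕ, ∃ P : ArithCircuit ℂ (Fin n × Fin n), P.IsFanInTwo ∧
      IsSyntacticallyMultilinear P ∧ P.Computes (perPoly (Fin n) ℂ) ∧ P.size ≤ n ^ c + c :=
  NcOrderedTransfer.smLiftPer_of_ncLift (ncLift_iff.mpr hB) heq

/-- **`B_nc ⟹ B`** (route-free name): the nc residual implies the route's declared residual
`TameOrSmLift` (stmt-ValiantsHypothesis-23662). [cite: HrubesWigdersonYehudayoff2011, Thm F.1] -/
theorem tameOrSmLift_of_ncLift (hB : NcSemantics.NcLift) : TameOrSmLift :=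
  NcOrderedTransfer.tameOrSmLift_of_ncLift (ncLift_iff.mpr hB)

/-- The converse-transfer piece of gen 4 is, on the route-free names, `A_nc → A` — the intended
signature of the aside stmt-ValiantsHypothesis-23448. [cite: HrubesWigdersonYehudayoff2011, Thm 1.11] -/
theorem smToNcPer_iff :
    CommutativityDialSplit.SmToNcPer ↔ (NcSemantics.PerNotNcVP → PerNotSmVP) := by
  rw [CommutativityDialSplit.SmToNcPer, perNotNcVP_iff]

/-- `A ⟺ A_nc ∧ (A_nc → A)` on the route-free names (exact conjunct split of the crux 23661 one level
down). [cite: HrubesWigdersonYehudayoff2011, Thm 1.11] -/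
theorem perNotSmVP_iff_ncSplit :
    PerNotSmVP ↔ NcSemantics.PerNotNcVP ∧ (NcSemantics.PerNotNcVP → PerNotSmVP) :=
  ⟨fun h => ⟨perNotNcVP_of_perNotSmVP h, fun _ => h⟩, fun h => h.2 h.1⟩

/-- Residual bookkeeping on the route-free names: `(A_nc → A) → (A → S) → B_nc`. [folklore] -/
theorem ncLift_of_smToNcPer (hT : NcSemantics.PerNotNcVP → PerNotSmVP)
    (hres : PerNotSmVP → _root_.ValiantsHypothesis) : NcSemantics.NcLift :=
  NcSemantics.ncLift_iff_residual.mpr fun hA => hres (hT hA)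

/-- The chain of the node on the route-free names: `S ⟹ A ⟹ A_nc` (both kernel). [folklore] -/
theorem chain_of_vh (hS : _root_.ValiantsHypothesis) : PerNotSmVP ∧ NcSemantics.PerNotNcVP :=
  ⟨CommutativityDialSplit.perNotSmVP_of_vh hS, NcSemantics.perNotNcVP_of_vh hS⟩

end Summit.ValiantsHypothesis.ValiantsHypothesis.Theorems.NcSemanticsBridge

end
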